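import Mathlib
import Literature.Analysis.FluidPDE.VectorCalculus
import Literature.Analysis.FluidPDE.VortexFilament.CurlEnergy
import Summits.NavierStokesRegularity.NavierStokesRegularity.Theorems.FilamentSkeletonRssSelectionBoxRJRungStraightSkewTools

/-!
# Route `FilamentSkeletonRss` · crux `SelectionBoxRJ` (stmt-NavierStokesRegularity-21220) — rung tools (R1, existence side):
# the frozen partner forcing of the datum of record, the smooth cut-off, and the scale-free profile margins

Lane `ns-filament-19175-p1` (g7); helper file `--supports stmt-NavierStokesRegularity-21220`, route-independent.  Consumed by
`…RungModelArcSlip.lean` / `…RungModelArc.lean` (the MODEL rung R1: the cut-off local-induction arc through the rung-0 waist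
datum, glued to straight arms).

* `exists_smooth_cutoff` — a `C^∞` cut-off `χ : ℝ → [0,1]`, `χ = 1` on `|t| ≤ S₁`, `χ = 0` on `|t| ≥ S₂` (product of two
  `Real.smoothTransition` ramps; no new definition is introduced).
* The FROZEN PARTNER FORCING of rung 0 along filament 1, in closed form
  `U t = (2Γ/π)/(4Γ/25 + 1 + t²) • ((2√Γ/5) e − t eₓ)` (`e = (0, 1/√2, 1/√2)`, `eₓ = (1, 0, 0)`): this is the box's
  regularised Biot–Savart integral of the straight partner `σ ↦ (−√Γ/5, 0, 0) + σ (0, −1/√2, 1/√2)` (circulation parameter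
  `γ = 4`) evaluated at the point `(√Γ/5, 0, 0) + t e` of straight filament 1 (`U_eq_lineBiotSavart`, via the tree's
  `SkeletonEquilibrium.Sketch.stub_lineBiotSavart`).  Lemmas: derivative (`U_hasDerivAt`), smoothness, the bounds
  `‖U t‖ ≤ (8/5)√Γ`, `‖U′ t‖ ≤ 12`, the sign `⟪U′ t, e⟫ ≥ 0` for `t ≤ 0`, and the rung-0 identities
  `⟪e, ½ℓ(t) − (21/5) e₃ × ℓ(t) + U t⟫ = √Γ·F(t/√Γ)`, `⟪U′ t, e⟫ = F′(t/√Γ) − ½` with the scale-free profile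
  `F(s) = a/(b + s²) + s/2 − k` of `…RungStraightSkewTools` (`a = 4/(5π)`, `k = (21/25)/√2`, `b = 4/25 + 1/Γ`).
* (The profile MARGINS used by the perturbative zero analysis live in `…RungModelProfileMargins.lean`.)

HONEST FRAMING.  Elementary calculus for the MODEL rung of a HYPOTHETICAL filament box; nothing here is a claim about
Navier–Stokes regularity or blow-up.
-/

set_option linter.dupNamespace false -- `Theorems.…Theorems`-style path/namespace repetition is the tree convention

noncomputable section

namespace Summit.NavierStokesRegularity.NavierStokesRegularity.Theorems

open Set Function Filter Real
open Literature.Analysis.FluidPDE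
open scoped InnerProductSpace Topology

namespace SelectionBoxRJRung

/-! ### A smooth cut-off -/

/-- **Smooth cut-off.** For `0 ≤ S₁ < S₂` there is a `C^∞` function `χ : ℝ → ℝ` with `χ = 1` on `|t| ≤ S₁`, `χ = 0` on
`|t| ≥ S₂` and `0 ≤ χ ≤ 1` (the product `ST((S₂ − t)/(S₂ − S₁)) · ST((S₂ + t)/(S₂ − S₁))` of two
`Real.smoothTransition` ramps). [folklore] -/
theorem exists_smooth_cutoff {S₁ S₂ : ℝ} (h : S₁ < S₂) :
    ∃ χ : ℝ → ℝ, (∀ n : ℕ∞, ContDiff ℝ n χ) ∧ (∀ t, |t| ≤ S₁ → χ t = 1) ∧ (∀ t, S₂ ≤ |t| → χ t = 0) ∧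
      (∀ t, 0 ≤ χ t) ∧ (∀ t, χ t ≤ 1) := by
  have hd : 0 < S₂ - S₁ := sub_pos.2 h
  refine ⟨fun t => Real.smoothTransition ((S₂ - t) / (S₂ - S₁)) * Real.smoothTransition ((S₂ + t) / (S₂ - S₁)),
    fun n => ?_, fun t ht => ?_, fun t ht => ?_, fun t => ?_, fun t => ?_⟩
  · have h1 : ContDiff ℝ n (fun t : ℝ => (S₂ - t) / (S₂ - S₁)) := by fun_prop
    have h2 : ContDiff ℝ n (fun t : ℝ => (S₂ + t) / (S₂ - S₁)) := by fun_prop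
    exact (Real.smoothTransition.contDiff.comp h1).mul (Real.smoothTransition.contDiff.comp h2)
  · have h1 : 1 ≤ (S₂ - t) / (S₂ - S₁) := by
      rw [le_div_iff₀ hd]; linarith [le_abs_self t]
    have h2 : 1 ≤ (S₂ + t) / (S₂ - S₁) := by
      rw [le_div_iff₀ hd]; linarith [neg_abs_le t]
    simp only [Real.smoothTransition.one_of_one_le h1, Real.smoothTransition.one_of_one_le h2, mul_one]
  · rcases le_or_gt 0 t with ht0 | ht0
    · rw [abs_of_nonneg ht0] at ht
      have h1 : (S₂ - t) / (S₂ - S₁) ≤ 0 := div_nonpos_of_nonpos_of_nonneg (by linarith) hd.le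
      simp only [Real.smoothTransition.zero_of_nonpos h1, zero_mul]
    · rw [abs_of_neg ht0] at ht
      have h2 : (S₂ + t) / (S₂ - S₁) ≤ 0 := div_nonpos_of_nonpos_of_nonneg (by linarith) hd.le
      simp only [Real.smoothTransition.zero_of_nonpos h2, mul_zero]
  · exact mul_nonneg (Real.smoothTransition.nonneg _) (Real.smoothTransition.nonneg _)
  · exact mul_le_one₀ (Real.smoothTransition.le_one _) (Real.smoothTransition.nonneg _)
      (Real.smoothTransition.le_one _)

/-! ### Explicit vectors of the datum of record -/

/-- `‖(1, 0, 0)‖ = 1`. [folklore] -/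
theorem norm_eX : ‖(WithLp.toLp 2 ![(1:ℝ), 0, 0] : EuclideanSpace ℝ (Fin 3))‖ = 1 := by
  rw [EuclideanSpace.norm_eq, Fin.sum_univ_three]; simp

/-- `⟪(2√Γ/5) e − t eₓ, e⟫ = 2√Γ/5` for the tilted unit tangent `e = (0, 1/√2, 1/√2)`. [folklore] -/
theorem inner_V_eT (Γ t : ℝ) :
    ⟪((2 * Real.sqrt Γ / 5) • (WithLp.toLp 2 ![0, (Real.sqrt 2)⁻¹, (Real.sqrt 2)⁻¹] : EuclideanSpace ℝ (Fin 3)) -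
        t • WithLp.toLp 2 ![(1:ℝ), 0, 0]),
      (WithLp.toLp 2 ![0, (Real.sqrt 2)⁻¹, (Real.sqrt 2)⁻¹] : EuclideanSpace ℝ (Fin 3))⟫_ℝ = 2 * Real.sqrt Γ / 5 := by
  rw [smul_vec3, smul_vec3, sub_vec3, inner_vec3]
  have hs := inv_sqrt_two_mul_self
  linear_combination (2 * (2 * Real.sqrt Γ / 5)) * hs

/-- `‖(2√Γ/5) e − t eₓ‖² = 4Γ/25 + t²` (`Γ ≥ 0`). [folklore] -/
theorem norm_sq_V (Γ t : ℝ) (hΓ : 0 ≤ Γ) :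
    ‖((2 * Real.sqrt Γ / 5) • (WithLp.toLp 2 ![0, (Real.sqrt 2)⁻¹, (Real.sqrt 2)⁻¹] : EuclideanSpace ℝ (Fin 3)) -
        t • WithLp.toLp 2 ![(1:ℝ), 0, 0])‖ ^ 2 = 4 * Γ / 25 + t ^ 2 := by
  rw [smul_vec3, smul_vec3, sub_vec3, VortexFilament.norm_sq_toLp_three]
  have hs := inv_sqrt_two_mul_self
  have hG : Real.sqrt Γ * Real.sqrt Γ = Γ := Real.mul_self_sqrt hΓ
  linear_combination (2 * (2 * Real.sqrt Γ / 5) ^ 2) * hs + (4 / 25) * hG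

/-! ### The frozen partner forcing `U` -/

/-- **Derivative of the frozen partner forcing.**  With `D t = 4Γ/25 + 1 + t²`, `q t = (2Γ/π)/D t`,
`V t = (2√Γ/5) e − t eₓ`: `U = q • V` has `U′ t = (−(2Γ/π)(2t)/(D t)²) • V t + q t • (−eₓ)`. [folklore] -/
theorem U_hasDerivAt {Γ : ℝ} (hΓ : 0 ≤ Γ) (U : ℝ → EuclideanSpace ℝ (Fin 3))
    (hU : ∀ t, U t = (2 * Γ / Real.pi / (4 * Γ / 25 + 1 + t ^ 2)) •
      ((2 * Real.sqrt Γ / 5) • (WithLp.toLp 2 ![0, (Real.sqrt 2)⁻¹, (Real.sqrt 2)⁻¹] : EuclideanSpace ℝ (Fin 3)) -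
        t • WithLp.toLp 2 ![(1:ℝ), 0, 0])) (t : ℝ) :
    HasDerivAt U ((-(2 * Γ / Real.pi) * (2 * t) / (4 * Γ / 25 + 1 + t ^ 2) ^ 2) •
        ((2 * Real.sqrt Γ / 5) • (WithLp.toLp 2 ![0, (Real.sqrt 2)⁻¹, (Real.sqrt 2)⁻¹] : EuclideanSpace ℝ (Fin 3)) -
          t • WithLp.toLp 2 ![(1:ℝ), 0, 0]) +
      (2 * Γ / Real.pi / (4 * Γ / 25 + 1 + t ^ 2)) • (-(WithLp.toLp 2 ![(1:ℝ), 0, 0] : EuclideanSpace ℝ (Fin 3)))) t := by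
  have hUf : U = fun t => (2 * Γ / Real.pi / (4 * Γ / 25 + 1 + t ^ 2)) •
      ((2 * Real.sqrt Γ / 5) • (WithLp.toLp 2 ![0, (Real.sqrt 2)⁻¹, (Real.sqrt 2)⁻¹] : EuclideanSpace ℝ (Fin 3)) -
        t • WithLp.toLp 2 ![(1:ℝ), 0, 0]) := funext hU
  have hD : ∀ s : ℝ, 4 * Γ / 25 + 1 + s ^ 2 ≠ 0 := fun s => by positivity
  -- the scalar factor
  have hq : HasDerivAt (fun s : ℝ => 2 * Γ / Real.pi / (4 * Γ / 25 + 1 + s ^ 2))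
      (-(2 * Γ / Real.pi) * (2 * t) / (4 * Γ / 25 + 1 + t ^ 2) ^ 2) t := by
    have hden : HasDerivAt (fun s : ℝ => 4 * Γ / 25 + 1 + s ^ 2) (2 * t) t := by
      have := (hasDerivAt_pow 2 t).const_add (4 * Γ / 25 + 1)
      simpa using this
    have h1 := (hden.inv (hD t)).const_mul (2 * Γ / Real.pi)
    have hfun : (fun s : ℝ => 2 * Γ / Real.pi / (4 * Γ / 25 + 1 + s ^ 2)) =
        fun s => 2 * Γ / Real.pi * (4 * Γ / 25 + 1 + s ^ 2)⁻¹ := by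
      funext s; rw [div_eq_mul_inv]
    rw [hfun]
    refine h1.congr_deriv ?_
    field_simp
  -- the vector factor
  have hV : HasDerivAt (fun s : ℝ =>
      ((2 * Real.sqrt Γ / 5) • (WithLp.toLp 2 ![0, (Real.sqrt 2)⁻¹, (Real.sqrt 2)⁻¹] : EuclideanSpace ℝ (Fin 3)) -
        s • WithLp.toLp 2 ![(1:ℝ), 0, 0])) (-(WithLp.toLp 2 ![(1:ℝ), 0, 0] : EuclideanSpace ℝ (Fin 3))) t := by
    have h1 : HasDerivAt (fun s : ℝ => s • (WithLp.toLp 2 ![(1:ℝ), 0, 0] : EuclideanSpace ℝ (Fin 3)))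
        ((1:ℝ) • (WithLp.toLp 2 ![(1:ℝ), 0, 0] : EuclideanSpace ℝ (Fin 3))) t := (hasDerivAt_id t).smul_const _
    rw [one_smul] at h1
    exact (hasDerivAt_const t _).sub h1 |>.congr_deriv (by simp)
  rw [hUf]
  exact (hq.smul hV).congr_deriv (add_comm _ _)

/-- The frozen partner forcing is differentiable. [folklore] -/
theorem U_differentiable {Γ : ℝ} (hΓ : 0 ≤ Γ) (U : ℝ → EuclideanSpace ℝ (Fin 3))
    (hU : ∀ t, U t = (2 * Γ / Real.pi / (4 * Γ / 25 + 1 + t ^ 2)) •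
      ((2 * Real.sqrt Γ / 5) • (WithLp.toLp 2 ![0, (Real.sqrt 2)⁻¹, (Real.sqrt 2)⁻¹] : EuclideanSpace ℝ (Fin 3)) -
        t • WithLp.toLp 2 ![(1:ℝ), 0, 0])) : Differentiable ℝ U :=
  fun t => (U_hasDerivAt hΓ U hU t).differentiableAt

/-- The frozen partner forcing is smooth (a rational function of `t` with positive denominator times an affine vector).
[folklore] -/
theorem U_contDiff {Γ : ℝ} (hΓ : 0 ≤ Γ) (U : ℝ → EuclideanSpace ℝ (Fin 3))
    (hU : ∀ t, U t = (2 * Γ / Real.pi / (4 * Γ / 25 + 1 + t ^ 2)) •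
      ((2 * Real.sqrt Γ / 5) • (WithLp.toLp 2 ![0, (Real.sqrt 2)⁻¹, (Real.sqrt 2)⁻¹] : EuclideanSpace ℝ (Fin 3)) -
        t • WithLp.toLp 2 ![(1:ℝ), 0, 0])) (n : WithTop ℕ∞) : ContDiff ℝ n U := by
  have hUf : U = fun t => (2 * Γ / Real.pi / (4 * Γ / 25 + 1 + t ^ 2)) •
      ((2 * Real.sqrt Γ / 5) • (WithLp.toLp 2 ![0, (Real.sqrt 2)⁻¹, (Real.sqrt 2)⁻¹] : EuclideanSpace ℝ (Fin 3)) -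
        t • WithLp.toLp 2 ![(1:ℝ), 0, 0]) := funext hU
  rw [hUf]
  have hv : ContDiff ℝ n (fun t : ℝ =>
      ((2 * Real.sqrt Γ / 5) • (WithLp.toLp 2 ![0, (Real.sqrt 2)⁻¹, (Real.sqrt 2)⁻¹] : EuclideanSpace ℝ (Fin 3)) -
        t • WithLp.toLp 2 ![(1:ℝ), 0, 0])) := by fun_prop
  have hden : ContDiff ℝ n (fun t : ℝ => 4 * Γ / 25 + 1 + t ^ 2) := by fun_prop
  have hq : ContDiff ℝ n (fun t : ℝ => 2 * Γ / Real.pi / (4 * Γ / 25 + 1 + t ^ 2)) :=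
    contDiff_const.div hden (fun s => by positivity)
  exact hq.smul hv

/-- **Size of the frozen forcing:** `‖U t‖ ≤ (8/5)√Γ` (`‖U‖² = q²(D − 1) ≤ (2Γ/π)²/D ≤ 25Γ/π²`). [folklore] -/
theorem norm_U_le {Γ : ℝ} (hΓ : 0 < Γ) (U : ℝ → EuclideanSpace ℝ (Fin 3))
    (hU : ∀ t, U t = (2 * Γ / Real.pi / (4 * Γ / 25 + 1 + t ^ 2)) •
      ((2 * Real.sqrt Γ / 5) • (WithLp.toLp 2 ![0, (Real.sqrt 2)⁻¹, (Real.sqrt 2)⁻¹] : EuclideanSpace ℝ (Fin 3)) -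
        t • WithLp.toLp 2 ![(1:ℝ), 0, 0])) (t : ℝ) :
    ‖U t‖ ≤ 8 / 5 * Real.sqrt Γ := by
  have hπ := Real.pi_gt_three
  have hG : 0 < Real.sqrt Γ := Real.sqrt_pos.2 hΓ
  have hG2 : Real.sqrt Γ ^ 2 = Γ := Real.sq_sqrt hΓ.le
  set D : ℝ := 4 * Γ / 25 + 1 + t ^ 2 with hDdef
  have hDpos : 0 < D := by positivity
  have hq : 0 ≤ 2 * Γ / Real.pi / D := by positivity
  rw [hU t, norm_smul, Real.norm_eq_abs, abs_of_nonneg hq]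
  have hV2 := norm_sq_V Γ t hΓ.le
  set V := ((2 * Real.sqrt Γ / 5) • (WithLp.toLp 2 ![0, (Real.sqrt 2)⁻¹, (Real.sqrt 2)⁻¹] : EuclideanSpace ℝ (Fin 3)) -
        t • WithLp.toLp 2 ![(1:ℝ), 0, 0]) with hVdef
  have hVn : 0 ≤ ‖V‖ := norm_nonneg _
  -- `‖V‖ ≤ D / (2√Γ/5)`: indeed `‖V‖ · (2√Γ/5) ≤ ‖V‖² ≤ D` since `2√Γ/5 ≤ ‖V‖`
  have hVlow : 2 * Real.sqrt Γ / 5 ≤ ‖V‖ := by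
    have : (2 * Real.sqrt Γ / 5) ^ 2 ≤ ‖V‖ ^ 2 := by rw [hV2]; nlinarith [sq_nonneg t, hG2]
    nlinarith [this, hVn, hG]
  have hVD : ‖V‖ * (2 * Real.sqrt Γ / 5) ≤ D := by
    calc ‖V‖ * (2 * Real.sqrt Γ / 5) ≤ ‖V‖ * ‖V‖ := mul_le_mul_of_nonneg_left hVlow hVn
      _ = ‖V‖ ^ 2 := by ring
      _ ≤ D := by rw [hV2, hDdef]; linarith
  -- conclude
  have hkey : 2 * Γ / Real.pi / D * ‖V‖ * (2 * Real.sqrt Γ / 5) ≤ 2 * Γ / Real.pi := by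
    calc 2 * Γ / Real.pi / D * ‖V‖ * (2 * Real.sqrt Γ / 5) = 2 * Γ / Real.pi * ((‖V‖ * (2 * Real.sqrt Γ / 5)) / D) := by
          field_simp
      _ ≤ 2 * Γ / Real.pi * 1 := by
          refine mul_le_mul_of_nonneg_left ?_ (by positivity)
          rw [div_le_one hDpos]; exact hVD
      _ = 2 * Γ / Real.pi := by ring
  -- `2Γ/π ≤ (8/5)√Γ · (2√Γ/5) = (16/25)Γ·... ` careful: we need `q‖V‖ ≤ (8/5)√Γ`, i.e. `q‖V‖(2√Γ/5) ≤ (16/25)Γ`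
  have h2 : 2 * Γ / Real.pi ≤ 8 / 5 * Real.sqrt Γ * (2 * Real.sqrt Γ / 5) := by
    rw [show 8 / 5 * Real.sqrt Γ * (2 * Real.sqrt Γ / 5) = 16 / 25 * Real.sqrt Γ ^ 2 by ring, hG2,
      div_le_iff₀ Real.pi_pos]
    have hππ := mul_lt_mul_of_pos_left Real.pi_gt_d2 hΓ
    nlinarith [hππ]
  have h3 : 2 * Γ / Real.pi / D * ‖V‖ * (2 * Real.sqrt Γ / 5) ≤ 8 / 5 * Real.sqrt Γ * (2 * Real.sqrt Γ / 5) :=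
    hkey.trans h2
  exact le_of_mul_le_mul_right h3 (by positivity)

/-- **Size of the derivative of the frozen forcing:** `‖U′ t‖ ≤ 12` (dimensionless; `|q′|‖V‖ ≤ (4Γ/π)/D` since
`2|t|‖V‖ ≤ 2‖V‖² ≤ 2D`, and `q ≤ (2Γ/π)/D`; `D ≥ 4Γ/25`). [folklore] -/
theorem norm_U_deriv_le {Γ : ℝ} (hΓ : 0 < Γ) (U : ℝ → EuclideanSpace ℝ (Fin 3))
    (hU : ∀ t, U t = (2 * Γ / Real.pi / (4 * Γ / 25 + 1 + t ^ 2)) •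
      ((2 * Real.sqrt Γ / 5) • (WithLp.toLp 2 ![0, (Real.sqrt 2)⁻¹, (Real.sqrt 2)⁻¹] : EuclideanSpace ℝ (Fin 3)) -
        t • WithLp.toLp 2 ![(1:ℝ), 0, 0])) (t : ℝ) :
    ‖deriv U t‖ ≤ 12 := by
  have hπ := Real.pi_gt_three
  rw [(U_hasDerivAt hΓ.le U hU t).deriv]
  set D : ℝ := 4 * Γ / 25 + 1 + t ^ 2 with hDdef
  have hDpos : 0 < D := by positivity
  set V := ((2 * Real.sqrt Γ / 5) • (WithLp.toLp 2 ![0, (Real.sqrt 2)⁻¹, (Real.sqrt 2)⁻¹] : EuclideanSpace ℝ (Fin 3)) -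
        t • WithLp.toLp 2 ![(1:ℝ), 0, 0]) with hVdef
  have hV2 : ‖V‖ ^ 2 = 4 * Γ / 25 + t ^ 2 := norm_sq_V Γ t hΓ.le
  have hVn : 0 ≤ ‖V‖ := norm_nonneg _
  have htV : |t| ≤ ‖V‖ := by
    have : |t| ^ 2 ≤ ‖V‖ ^ 2 := by rw [hV2, sq_abs]; nlinarith
    exact abs_le_of_sq_le_sq' (by nlinarith [this, abs_nonneg t]) hVn |>.2 |> fun h => by
      nlinarith [this, abs_nonneg t, hVn, sq_nonneg (|t| - ‖V‖)]
  -- first summand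
  have h1 : ‖(-(2 * Γ / Real.pi) * (2 * t) / D ^ 2) • V‖ ≤ 4 * Γ / Real.pi / D := by
    rw [norm_smul, Real.norm_eq_abs]
    have habs : |-(2 * Γ / Real.pi) * (2 * t) / D ^ 2| = 2 * Γ / Real.pi * (2 * |t|) / D ^ 2 := by
      rw [abs_div, abs_mul, abs_neg, abs_of_pos (by positivity : (0:ℝ) < 2 * Γ / Real.pi), abs_mul,
        abs_of_pos (by norm_num : (0:ℝ) < 2), abs_of_pos (by positivity : (0:ℝ) < D ^ 2)]
    rw [habs]
    have hkey : 2 * |t| * ‖V‖ ≤ 2 * D := by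
      calc 2 * |t| * ‖V‖ ≤ 2 * ‖V‖ * ‖V‖ := by nlinarith [htV, hVn, abs_nonneg t]
        _ = 2 * ‖V‖ ^ 2 := by ring
        _ ≤ 2 * D := by rw [hV2, hDdef]; nlinarith
    calc 2 * Γ / Real.pi * (2 * |t|) / D ^ 2 * ‖V‖ = 2 * Γ / Real.pi * (2 * |t| * ‖V‖) / D ^ 2 := by ring
      _ ≤ 2 * Γ / Real.pi * (2 * D) / D ^ 2 := by gcongr
      _ = 4 * Γ / Real.pi / D := by field_simp; ring
  -- second summand
  have h2 : ‖(2 * Γ / Real.pi / D) • (-(WithLp.toLp 2 ![(1:ℝ), 0, 0] : EuclideanSpace ℝ (Fin 3)))‖ = 2 * Γ / Real.pi / D := by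
    rw [norm_smul, norm_neg, norm_eX, mul_one, Real.norm_eq_abs, abs_of_pos (by positivity)]
  have hsum : ‖(-(2 * Γ / Real.pi) * (2 * t) / D ^ 2) • V +
      (2 * Γ / Real.pi / D) • (-(WithLp.toLp 2 ![(1:ℝ), 0, 0] : EuclideanSpace ℝ (Fin 3)))‖ ≤ 6 * Γ / Real.pi / D := by
    calc _ ≤ ‖(-(2 * Γ / Real.pi) * (2 * t) / D ^ 2) • V‖ +
          ‖(2 * Γ / Real.pi / D) • (-(WithLp.toLp 2 ![(1:ℝ), 0, 0] : EuclideanSpace ℝ (Fin 3)))‖ := norm_add_le _ _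
      _ ≤ 4 * Γ / Real.pi / D + 2 * Γ / Real.pi / D := by rw [h2]; linarith [h1]
      _ = 6 * Γ / Real.pi / D := by ring
  have hfin : 6 * Γ / Real.pi / D ≤ 12 := by
    rw [div_le_iff₀ hDpos, div_le_iff₀ Real.pi_pos]
    have hD4 : 4 * Γ / 25 ≤ D := by rw [hDdef]; nlinarith
    have h1' := mul_le_mul_of_nonneg_right hD4 Real.pi_pos.le
    have h2' := mul_lt_mul_of_pos_left Real.pi_gt_d2 hΓ
    nlinarith [h1', h2']
  exact hsum.trans hfin

/-! ### The frozen forcing against the tangent: sign and the rung-0 identities -/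

/-- **Axial derivative of the frozen forcing:** `⟪U′ t, e⟫ = −(2Γ/π)(2t)(2√Γ/5)/D²` (`D = 4Γ/25 + 1 + t²`); in particular
it is `≥ 0` for `t ≤ 0`. [folklore] -/
theorem inner_U_deriv_eT {Γ : ℝ} (hΓ : 0 ≤ Γ) (U : ℝ → EuclideanSpace ℝ (Fin 3))
    (hU : ∀ t, U t = (2 * Γ / Real.pi / (4 * Γ / 25 + 1 + t ^ 2)) •
      ((2 * Real.sqrt Γ / 5) • (WithLp.toLp 2 ![0, (Real.sqrt 2)⁻¹, (Real.sqrt 2)⁻¹] : EuclideanSpace ℝ (Fin 3)) -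
        t • WithLp.toLp 2 ![(1:ℝ), 0, 0])) (t : ℝ) :
    ⟪deriv U t, (WithLp.toLp 2 ![0, (Real.sqrt 2)⁻¹, (Real.sqrt 2)⁻¹] : EuclideanSpace ℝ (Fin 3))⟫_ℝ =
      -(2 * Γ / Real.pi) * (2 * t) / (4 * Γ / 25 + 1 + t ^ 2) ^ 2 * (2 * Real.sqrt Γ / 5) := by
  rw [(U_hasDerivAt hΓ U hU t).deriv, inner_add_left, inner_smul_left, inner_V_eT, inner_smul_left, inner_neg_left]
  have h0 : ⟪(WithLp.toLp 2 ![(1:ℝ), 0, 0] : EuclideanSpace ℝ (Fin 3)),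
      (WithLp.toLp 2 ![0, (Real.sqrt 2)⁻¹, (Real.sqrt 2)⁻¹] : EuclideanSpace ℝ (Fin 3))⟫_ℝ = 0 := by
    rw [inner_vec3]; ring
  rw [h0]
  simp

/-- For `t ≤ 0` the frozen forcing is axially STRETCHING along the tangent: `⟪U′ t, e⟫ ≥ 0`. [folklore] -/
theorem inner_U_deriv_eT_nonneg {Γ : ℝ} (hΓ : 0 ≤ Γ) (U : ℝ → EuclideanSpace ℝ (Fin 3))
    (hU : ∀ t, U t = (2 * Γ / Real.pi / (4 * Γ / 25 + 1 + t ^ 2)) •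
      ((2 * Real.sqrt Γ / 5) • (WithLp.toLp 2 ![0, (Real.sqrt 2)⁻¹, (Real.sqrt 2)⁻¹] : EuclideanSpace ℝ (Fin 3)) -
        t • WithLp.toLp 2 ![(1:ℝ), 0, 0])) {t : ℝ} (ht : t ≤ 0) :
    0 ≤ ⟪deriv U t, (WithLp.toLp 2 ![0, (Real.sqrt 2)⁻¹, (Real.sqrt 2)⁻¹] : EuclideanSpace ℝ (Fin 3))⟫_ℝ := by
  rw [inner_U_deriv_eT hΓ U hU t]
  have hG : 0 ≤ Real.sqrt Γ := Real.sqrt_nonneg Γ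
  have hD : 0 < (4 * Γ / 25 + 1 + t ^ 2) ^ 2 := by positivity
  have hnum : 0 ≤ -(2 * Γ / Real.pi) * (2 * t) := by
    have : 0 ≤ 2 * Γ / Real.pi := by positivity
    nlinarith
  have := div_nonneg hnum hD.le
  positivity

/-- **Rung-0 identity for the slip of the straight filament under the frozen forcing.**  With `ℓ t = (√Γ/5, 0, 0) + t e`:
`⟪e, ½ ℓ(t) − (21/5) e₃ × ℓ(t) + U t⟫ = √Γ · F(t/√Γ)` with `F(s) = a/(b + s²) + s/2 − k`, `a = 4/(5π)`, `k = (21/25)/√2`,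
`b = 4/25 + 1/Γ` — the closed form of `straightSkew_w_closed_form`, now read with the forcing frozen along the parameter.
[folklore] -/
theorem line_slip_closed_form {Γ : ℝ} (hΓ : 0 < Γ) (U : ℝ → EuclideanSpace ℝ (Fin 3))
    (hU : ∀ t, U t = (2 * Γ / Real.pi / (4 * Γ / 25 + 1 + t ^ 2)) •
      ((2 * Real.sqrt Γ / 5) • (WithLp.toLp 2 ![0, (Real.sqrt 2)⁻¹, (Real.sqrt 2)⁻¹] : EuclideanSpace ℝ (Fin 3)) -
        t • WithLp.toLp 2 ![(1:ℝ), 0, 0])) (t : ℝ) :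
    ⟪(WithLp.toLp 2 ![0, (Real.sqrt 2)⁻¹, (Real.sqrt 2)⁻¹] : EuclideanSpace ℝ (Fin 3)),
      ((1 / 2 : ℝ) • (WithLp.toLp 2 ![Real.sqrt Γ / 5, 0, 0] + t • WithLp.toLp 2 ![0, (Real.sqrt 2)⁻¹, (Real.sqrt 2)⁻¹]) -
        (21 / 5 : ℝ) • cross (EuclideanSpace.single 2 1)
          (WithLp.toLp 2 ![Real.sqrt Γ / 5, 0, 0] + t • WithLp.toLp 2 ![0, (Real.sqrt 2)⁻¹, (Real.sqrt 2)⁻¹])) + U t⟫_ℝ =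
      Real.sqrt Γ * (4 / (5 * Real.pi) / (4 / 25 + 1 / Γ + (t / Real.sqrt Γ) ^ 2) + (t / Real.sqrt Γ) / 2
        - 21 / 25 * (Real.sqrt 2)⁻¹) := by
  have hG : 0 < Real.sqrt Γ := Real.sqrt_pos.2 hΓ
  have hG2 : Real.sqrt Γ ^ 2 = Γ := Real.sq_sqrt hΓ.le
  have hs := inv_sqrt_two_mul_self
  have h4 : ⟪(WithLp.toLp 2 ![0, (Real.sqrt 2)⁻¹, (Real.sqrt 2)⁻¹] : EuclideanSpace ℝ (Fin 3)),
      (WithLp.toLp 2 ![Real.sqrt Γ / 5, 0, 0] : EuclideanSpace ℝ (Fin 3)) +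
        t • WithLp.toLp 2 ![0, (Real.sqrt 2)⁻¹, (Real.sqrt 2)⁻¹]⟫_ℝ = t := by
    rw [pt₁, inner_vec3]; linear_combination (2 * t) * hs
  have h5 : ⟪(WithLp.toLp 2 ![0, (Real.sqrt 2)⁻¹, (Real.sqrt 2)⁻¹] : EuclideanSpace ℝ (Fin 3)),
      cross (EuclideanSpace.single 2 1)
        ((WithLp.toLp 2 ![Real.sqrt Γ / 5, 0, 0] : EuclideanSpace ℝ (Fin 3)) +
          t • WithLp.toLp 2 ![0, (Real.sqrt 2)⁻¹, (Real.sqrt 2)⁻¹])⟫_ℝ = (Real.sqrt 2)⁻¹ * (Real.sqrt Γ / 5) := by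
    rw [single_two_eq_vec3, pt₁, cross_vec3, inner_vec3]; ring
  have hUe : ⟪(WithLp.toLp 2 ![0, (Real.sqrt 2)⁻¹, (Real.sqrt 2)⁻¹] : EuclideanSpace ℝ (Fin 3)), U t⟫_ℝ =
      2 * Γ / Real.pi / (4 * Γ / 25 + 1 + t ^ 2) * (2 * Real.sqrt Γ / 5) := by
    rw [hU t, inner_smul_right, real_inner_comm, inner_V_eT]
  rw [inner_add_right, inner_sub_right, inner_smul_right, inner_smul_right, h4, h5, hUe, div_pow, hG2]
  have hD : 4 * Γ / 25 + 1 + t ^ 2 ≠ 0 := by positivity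
  have hΓne : Γ ≠ 0 := hΓ.ne'
  have hD' : 4 / 25 + 1 / Γ + t ^ 2 / Γ = (4 * Γ / 25 + 1 + t ^ 2) / Γ := by
    field_simp
  rw [hD']
  generalize hGdef : Real.sqrt Γ = G at hG hG2 ⊢
  subst hG2
  have hG0 : G ≠ 0 := hG.ne'
  field_simp
  ring

/-- **The axial forcing derivative is the strain part of the rung-0 slope:** `⟪U′ t, e⟫ = −2a s/(b + s²)²` at `s = t/√Γ`
(`a = 4/(5π)`, `b = 4/25 + 1/Γ`), i.e. `F′(s) − ½`. [folklore] -/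
theorem inner_U_deriv_eT_eq_profile {Γ : ℝ} (hΓ : 0 < Γ) (U : ℝ → EuclideanSpace ℝ (Fin 3))
    (hU : ∀ t, U t = (2 * Γ / Real.pi / (4 * Γ / 25 + 1 + t ^ 2)) •
      ((2 * Real.sqrt Γ / 5) • (WithLp.toLp 2 ![0, (Real.sqrt 2)⁻¹, (Real.sqrt 2)⁻¹] : EuclideanSpace ℝ (Fin 3)) -
        t • WithLp.toLp 2 ![(1:ℝ), 0, 0])) (t : ℝ) :
    ⟪deriv U t, (WithLp.toLp 2 ![0, (Real.sqrt 2)⁻¹, (Real.sqrt 2)⁻¹] : EuclideanSpace ℝ (Fin 3))⟫_ℝ =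
      -(2 * (4 / (5 * Real.pi)) * (t / Real.sqrt Γ) / (4 / 25 + 1 / Γ + (t / Real.sqrt Γ) ^ 2) ^ 2) := by
  rw [inner_U_deriv_eT hΓ.le U hU t]
  have hG : 0 < Real.sqrt Γ := Real.sqrt_pos.2 hΓ
  have hG2 : Real.sqrt Γ ^ 2 = Γ := Real.sq_sqrt hΓ.le
  have hD : 4 * Γ / 25 + 1 + t ^ 2 ≠ 0 := by positivity
  have hD' : 4 / 25 + 1 / Γ + (t / Real.sqrt Γ) ^ 2 ≠ 0 := by positivity
  field_simp
  rw [hG2]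
  have hG3 : Real.sqrt Γ ^ 3 = Γ * Real.sqrt Γ := by rw [pow_succ, hG2]
  nlinarith [hG2, hG3]

end SelectionBoxRJRung

end Summit.NavierStokesRegularity.NavierStokesRegularity.Theorems
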